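import Summits.FinalStateConjecture.FinalStateConjecture.Theorems.SwallowTheDatumUniversalWitnessFamilyStubCapEndAux1
import Summits.FinalStateConjecture.FinalStateConjecture.Theorems.SwallowTheDatumUniversalWitnessFamilyStubCapEndAux2
import Literature.Geometry.Lorentzian.ModelDataProofs
import HarnessLib

/-!
# Crux `SwallowTheDatum.UniversalWitnessFamily` (stmt-FinalStateConjecture-10051), line `Sketch`,
# stub `stub_capEnd`: capping the end through the inversion chart

The registered stub `stub_capEnd` of skeleton v6 (`Cruxes/UniversalWitnessFamily/Lines/Sketch.lean`;
verbatim the sibling crux 10052's `stub_capEnd`), proved: for `M, ρ₃, X₃ > 0` with `X₃ ρ₃ = (M/2)²`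
and a datum `G` on the `y`-chart `ℝ³`, `CapEndAt M ρ₃ X₃ G` holds (engine interface
`Theorems/SwallowTheDatumParametricKerrBurialEngine.lean`; inversion calculus, Kelvin's identity and
the read data in `…StubCapEndAux2.lean`, patching of data on `ℝ³` in `…StubCapEndAux1.lean`).

* (i) `exists_capDatum` — the datum `Ĝ` on the `x`-chart: the blend
  `χ δ + (1 − χ) invReadH G`, `(1 − χ) invReadK G` of the flat form with the inverted readings by a
  cut-off `χ` (`= 1` near the ball of radius `1/8`, `= 0` beyond radius `1/4`; the readings are smooth
  off the origin and positive definite, `D(inv ρ₃)_x` being injective); beyond radius `1/4` it IS the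
  reading, i.e. the read datum `(X₃⁻² inv^* h_G, X₃⁻¹ inv^* k_G)` on the punctured slice, whence the
  vacuum constraints transfer pointwise (`read_vacAt`, `vacAt_of_model`);
* (ii) `exists_transplant` — a unit-scale datum `D̂` agreeing with `Ĝ` beyond radius `32` and equal to
  the sheet-2 far field `((1 + M/(2X₃|x|))⁴ δ, 0)` on `{1/4 < |x| < 2}` transplants back: `P` is patched
  (`exists_initialDataSet_of_pieces`) from `G` on `{|y| < ρ₃/48}`, the un-read datum
  `(X₃² inv^* h_D̂, X₃ inv^* k_D̂)` on `{ρ₃/48 ≤ |y| < ρ₃}` and the exact isotropic Schwarzschild(`M`)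
  field beyond; consecutive pieces agree on the open overlaps `{0 < |y| < ρ₃/32}` (un-reading the
  reading is the identity: involution + chain rule) and `{ρ₃/2 < |y| < 4ρ₃}` (KELVIN'S IDENTITY
  `kelvin_identity`: the inversion in the throat sphere is an isometry of `(1 + M/2|y|)⁴ δ`); the
  vacuum constraints transfer piecewise, the exact piece being the vacuum datum
  `Schwarzschild.conformalData` (`conformalData_isVacuumConstraintSolution_holds`).

References: C. W. Misner, K. S. Thorne, J. A. Wheeler, *Gravitation* (1973), §31.7 (the inversion
isometry of the Schwarzschild throat); R. Bartnik, J. Isenberg, *The constraint equations* (2004), §2;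
J. Corvino, Comm. Math. Phys. 214 (2000), §4.
-/

-- the doubled `FinalStateConjecture` path component is the summit/problem naming scheme, not a mistake
set_option linter.dupNamespace false
-- instance problems on the nested operator type `E3 →L[ℝ] E3 →L[ℝ] ℝ` (`ContDiff.smul`) need one more
-- level of pending instance synthesis than the default
set_option maxSynthPendingDepth 2

noncomputable section

namespace Summit.FinalStateConjecture.FinalStateConjecture.Theorems.SwallowTheDatum.UniversalWitnessFamily

open scoped Manifold ContDiff Topology InnerProductSpace RealInnerProductSpace
open Set Filter Function TopologicalSpace Literature.Geometry.Lorentzian Literature.Geometry.Lorentzian.InitialDataSet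
open Summit.FinalStateConjecture.FinalStateConjecture.Theorems.SwallowTheDatum.ParametricKerrBurial
  (CapEndAt VacAt inv invReadH invReadK)

/-! ### Part (i): the inverted reading as a datum on `ℝ³` -/

section Main

variable {M ρ₃ X₃ : ℝ}

/-- **The inverted reading exists as a datum on `ℝ³`, and the vacuum constraints transfer**: blend
the flat form `δ` near the origin with the inverted readings `invReadH/invReadK` (smooth off the
origin) by a cut-off equal to `1` on `{‖x‖ ≤ 3/16}` and to `0` on `{1/4 ≤ ‖x‖}`; beyond radius
`1/4` the datum IS the reading, i.e. the restriction to `{1/4 < ‖x‖}` of the pull-back of `G` along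
the inversion rescaled by `(h, k) ↦ (X₃⁻² h, X₃⁻¹ k)`, both operations preserving the vacuum
constraints pointwise. Corvino 2000, §4; Bartnik–Isenberg 2004, §2. [cite: BartnikIsenberg2004, §2] -/
theorem exists_capDatum (G : InitialDataSet (𝓡 3) E3) (hρ : 0 < ρ₃) (hX : 0 < X₃) :
    ∃ Ghat : InitialDataSet (𝓡 3) E3,
      (∀ x : E3, 1 / 4 < ‖x‖ → Ghat.coordH x = invReadH G ρ₃ X₃ x ∧ Ghat.coordK x = invReadK G ρ₃ X₃ x) ∧
      (∀ x : E3, 1 / 4 < ‖x‖ → VacAt G (inv ρ₃ x) → VacAt Ghat x) := by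
  -- the cut-off `χ(x) = S(4 − 64‖x‖²)`: `= 1` near the ball of radius `1/8`, `= 0` beyond radius `1/4`
  set χ : E3 → ℝ := fun x ↦ Real.smoothTransition (4 - ‖x‖ ^ 2 / (1 / 8 : ℝ) ^ 2) with hχ
  have h8 : (0 : ℝ) < 1 / 8 := by norm_num
  have hχs : ContDiff ℝ ∞ χ := ParametricKerrBurial.contDiff_cutoff (1 / 8)
  have hχ1 : ∀ y : E3, ‖y‖ ≤ 1 / 8 → ∀ᶠ z in 𝓝 y, χ z = 1 := fun y hy ↦ by
    have hy' : ‖y‖ < 3 / 2 * (1 / 8 : ℝ) := by linarith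
    filter_upwards [(isOpen_lt continuous_norm continuous_const).mem_nhds hy'] with z hz
    exact ParametricKerrBurial.cutoff_eq_one h8 hz
  have hχ0 : ∀ x : E3, 1 / 4 < ‖x‖ → χ x = 0 := fun x hx ↦
    ParametricKerrBurial.cutoff_eq_zero h8 (by linarith)
  have hχ01 : ∀ x, 0 ≤ χ x ∧ χ x ≤ 1 := fun x ↦
    ⟨Real.smoothTransition.nonneg _, Real.smoothTransition.le_one _⟩
  have hχlt : ∀ x : E3, χ x < 1 → x ≠ 0 := by
    intro x hx h0
    have h1 : χ x = 1 := ParametricKerrBurial.cutoff_eq_one h8 (by rw [h0, norm_zero]; norm_num)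
    linarith
  -- smoothness of the readings beyond radius `1/8`
  have hsub : {x : E3 | (1 / 8 : ℝ) < ‖x‖} ⊆ {x : E3 | x ≠ 0} := by
    intro x hx h0
    rw [mem_setOf_eq, h0, norm_zero] at hx
    linarith
  have hF : ContDiffOn ℝ ∞ (invReadH G ρ₃ X₃) {x : E3 | (1 / 8 : ℝ) < ‖x‖} :=
    (contDiffOn_invReadH G ρ₃ X₃).mono hsub
  have hK : ContDiffOn ℝ ∞ (invReadK G ρ₃ X₃) {x : E3 | (1 / 8 : ℝ) < ‖x‖} :=
    (contDiffOn_invReadK G ρ₃ X₃).mono hsub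
  obtain ⟨Ghat, hH, hKK⟩ := ParametricKerrBurial.exists_initialDataSet_of_contDiff
    (fun x ↦ χ x • (innerSL ℝ : E3 →L[ℝ] E3 →L[ℝ] ℝ) + (1 - χ x) • invReadH G ρ₃ X₃ x)
    (fun x ↦ (1 - χ x) • invReadK G ρ₃ X₃ x)
    ((hχs.smul contDiff_const).add (ParametricKerrBurial.contDiff_one_sub_smul hχs hχ1 hF))
    (ParametricKerrBurial.contDiff_one_sub_smul hχs hχ1 hK)
    (fun x v w ↦ by
      have h1 : (innerSL ℝ (E := E3)) v w = (innerSL ℝ (E := E3)) w v := real_inner_comm w v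
      simp only [add_apply, smul_apply, smul_eq_mul]
      rw [h1, invReadH_symm G ρ₃ X₃ x v w])
    (fun x v hv ↦ by
      obtain ⟨h0, h1⟩ := hχ01 x
      have hvv : 0 < ⟪v, v⟫ := real_inner_self_pos.2 hv
      simp only [add_apply, smul_apply, smul_eq_mul]
      rcases h1.lt_or_eq with h1 | h1
      · exact add_pos_of_nonneg_of_pos (mul_nonneg h0 hvv.le)
          (mul_pos (sub_pos.2 h1) (invReadH_pos G hρ.ne' hX (hχlt x h1) hv))
      · rw [h1, sub_self, zero_mul, add_zero, one_mul]
        exact hvv)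
    (fun x v w ↦ by
      simp only [smul_apply, smul_eq_mul, invReadK_symm G ρ₃ X₃ x v w])
  -- beyond radius `1/4` the datum IS the inverted reading
  have hread : ∀ x : E3, 1 / 4 < ‖x‖ →
      Ghat.coordH x = invReadH G ρ₃ X₃ x ∧ Ghat.coordK x = invReadK G ρ₃ X₃ x := by
    intro x hx
    have h0 := hχ0 x hx
    refine ⟨?_, ?_⟩
    · rw [congrFun hH x]
      simp only [h0, zero_smul, sub_zero, one_smul, zero_add]
    · rw [congrFun hKK x]
      simp only [h0, sub_zero, one_smul]
  refine ⟨Ghat, hread, fun x hx hvac ↦ ?_⟩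
  -- the vacuum constraints transfer through the read datum on the punctured slice
  refine vacAt_of_model Ghat
    ((G.comap (inv ρ₃ ∘ Subtype.val) (contMDiff_invVal ρ₃) (injective_mfderiv_invVal hρ.ne')).homothety
      X₃⁻¹ (inv_pos.2 hX))
    (W := {z : E3 | 1 / 4 < ‖z‖}) (isOpen_lt continuous_const continuous_norm)
    (fun z hz ↦ lt_trans (by norm_num : (0 : ℝ) < 1 / 4) hz) hx (fun z hz hzW ↦ ?_) ?_
  · obtain ⟨hHz, hKz⟩ := hread z hzW
    refine ⟨fun v w ↦ ?_, fun v w ↦ ?_⟩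
    · rw [read_h_inner G hρ.ne' (inv_pos.2 hX), ← coordH_apply Ghat, hHz, invReadH_apply, inv_pow]
      rfl
    · rw [read_k G hρ.ne' (inv_pos.2 hX), ← coordK_apply Ghat, hKz, invReadK_apply]
      rfl
  · exact read_vacAt G hρ.ne' (inv_pos.2 hX) ⟨x, _⟩ hvac

/-! ### Part (ii): transplanting a unit-scale datum back through the inversion -/

/-- **Transplanting back through the inversion.** Given the cap datum `Ĝ` of part (i) and a datum
`D̂` which agrees with `Ĝ` beyond radius `32` and is the exact sheet-2 far field
`((1 + M/(2X₃|x|))⁴ δ, 0)` on `{1/4 < |x| < 2}`, the datum `P` on the `y`-chart is patched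
(`exists_initialDataSet_of_pieces`) from `G` on `{|y| < ρ₃/48}`, the UN-READ datum
`(X₃² inv^* h_D̂, X₃ inv^* k_D̂)` on `{ρ₃/48 ≤ |y| < ρ₃}` and the exact isotropic Schwarzschild(`M`)
field beyond: consecutive pieces agree on the open overlaps `{0 < |y| < ρ₃/32}` (un-reading the
reading is the identity: `inv` is an involution, chain rule) and `{ρ₃/2 < |y| < 4ρ₃}` (Kelvin's
identity, `kelvin_identity`). The vacuum constraints transfer piecewise (`vacAt_of_model`,
`vacAt_of_eqOn`; the exact piece is the vacuum datum `Schwarzschild.conformalData`).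
Misner–Thorne–Wheeler 1973, §31.7; Bartnik–Isenberg 2004, §2. [cite: BartnikIsenberg2004, §2] -/
theorem exists_transplant (hM : 0 < M) (hρ : 0 < ρ₃) (hX : 0 < X₃) (hrel : X₃ * ρ₃ = (M / 2) ^ 2)
    (G Ghat Dhat : InitialDataSet (𝓡 3) E3)
    (hGhat : ∀ x : E3, 1 / 4 < ‖x‖ → Ghat.coordH x = invReadH G ρ₃ X₃ x ∧ Ghat.coordK x = invReadK G ρ₃ X₃ x)
    (hS : ∀ x : E3, 32 < ‖x‖ → Dhat.SameAt Ghat x)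
    (hfar : ∀ x : E3, 1 / 4 < ‖x‖ → ‖x‖ < 2 →
      (∀ v w : E3, Dhat.h.inner x v w = (1 + M / (2 * X₃ * ‖x‖)) ^ 4 * ⟪v, w⟫) ∧ Dhat.k x = 0) :
    ∃ P : InitialDataSet (𝓡 3) E3,
      (∀ y : E3, ρ₃ / 2 < ‖y‖ →
        (∀ v w : E3, P.h.inner y v w = Schwarzschild.conformalFactor M y ^ 4 * ⟪v, w⟫) ∧ P.k y = 0) ∧
      (∀ y : E3, ‖y‖ < ρ₃ / 32 → P.SameAt G y) ∧
      (∀ y : E3, ρ₃ / 2 < ‖y‖ → VacAt P y) ∧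
      (∀ y : E3, ρ₃ / 64 < ‖y‖ → ‖y‖ < 2 * ρ₃ → VacAt Dhat (inv ρ₃ y) → VacAt P y) ∧
      (∀ y : E3, ‖y‖ < ρ₃ / 32 → VacAt G y → VacAt P y) := by
  classical
  -- the un-read fields of `D̂` and the exact isotropic Schwarzschild field
  set uH : E3 → E3 →L[ℝ] E3 →L[ℝ] ℝ := fun y ↦
    X₃ ^ 2 • (Dhat.coordH (inv ρ₃ y)).bilinearComp (fderiv ℝ (inv ρ₃) y) (fderiv ℝ (inv ρ₃) y) with huH
  set uK : E3 → E3 →L[ℝ] E3 →L[ℝ] ℝ := fun y ↦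
    X₃ • (Dhat.coordK (inv ρ₃ y)).bilinearComp (fderiv ℝ (inv ρ₃) y) (fderiv ℝ (inv ρ₃) y) with huK
  set sH : E3 → E3 →L[ℝ] E3 →L[ℝ] ℝ := fun y ↦
    Schwarzschild.conformalFactor M y ^ 4 • (innerSL ℝ : E3 →L[ℝ] E3 →L[ℝ] ℝ) with hsH
  -- the patched fields
  set pH : E3 → E3 →L[ℝ] E3 →L[ℝ] ℝ := fun y ↦
    if ‖y‖ < ρ₃ / 48 then G.coordH y else if ‖y‖ < ρ₃ then uH y else sH y with hpH
  set pK : E3 → E3 →L[ℝ] E3 →L[ℝ] ℝ := fun y ↦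
    if ‖y‖ < ρ₃ / 48 then G.coordK y else if ‖y‖ < ρ₃ then uK y else 0 with hpK
  have huH_apply : ∀ y v w : E3, uH y v w =
      X₃ ^ 2 * Dhat.coordH (inv ρ₃ y) (fderiv ℝ (inv ρ₃) y v) (fderiv ℝ (inv ρ₃) y w) := fun y v w ↦ rfl
  have huK_apply : ∀ y v w : E3, uK y v w =
      X₃ * Dhat.coordK (inv ρ₃ y) (fderiv ℝ (inv ρ₃) y v) (fderiv ℝ (inv ρ₃) y w) := fun y v w ↦ rfl
  have hsH_apply : ∀ y v w : E3, sH y v w = Schwarzschild.conformalFactor M y ^ 4 * ⟪v, w⟫ :=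
    fun y v w ↦ rfl
  -- (E1) un-reading the reading gives `G` back on `{0 < ‖z‖ < ρ₃/32}`
  have hE1 : ∀ z : E3, z ≠ 0 → ‖z‖ < ρ₃ / 32 → uH z = G.coordH z ∧ uK z = G.coordK z := by
    intro z hz0 hz
    have h32 : 32 < ‖inv ρ₃ z‖ := (lt_norm_sInv_iff hρ.le hz0 32).2 (by linarith)
    have h4 : 1 / 4 < ‖inv ρ₃ z‖ := lt_trans (by norm_num) h32
    obtain ⟨hSh, hSk⟩ := hS _ h32
    obtain ⟨hGh, hGk⟩ := hGhat _ h4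
    have hX2 : X₃ ^ 2 ≠ 0 := pow_ne_zero 2 hX.ne'
    refine ⟨?_, ?_⟩
    · ext v w
      rw [huH_apply, coordH_apply, hSh, ← coordH_apply Ghat, hGh, invReadH_apply,
        fderiv_sInv_apply_fderiv_sInv hρ.ne' hz0, fderiv_sInv_apply_fderiv_sInv hρ.ne' hz0, sInv_sInv hρ.ne',
        ← mul_assoc, mul_inv_cancel₀ hX2, one_mul]
    · ext v w
      rw [huK_apply, coordK_apply, hSk, ← coordK_apply Ghat, hGk, invReadK_apply,
        fderiv_sInv_apply_fderiv_sInv hρ.ne' hz0, fderiv_sInv_apply_fderiv_sInv hρ.ne' hz0, sInv_sInv hρ.ne',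
        ← mul_assoc, mul_inv_cancel₀ hX.ne', one_mul]
  -- (E2) Kelvin: un-reading the sheet-2 far field gives the exact Schwarzschild field on `{ρ₃/2 < ‖z‖ < 4ρ₃}`
  have hE2 : ∀ z : E3, ρ₃ / 2 < ‖z‖ → ‖z‖ < 4 * ρ₃ → uH z = sH z ∧ uK z = 0 := by
    intro z hz1 hz2
    have hz0 : z ≠ 0 := fun h ↦ by rw [h, norm_zero] at hz1; linarith
    have hx1 : 1 / 4 < ‖inv ρ₃ z‖ := (lt_norm_sInv_iff hρ.le hz0 _).2 (by linarith)
    have hx2 : ‖inv ρ₃ z‖ < 2 := (norm_sInv_lt_iff hρ.le hz0 _).2 (by linarith)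
    obtain ⟨hfh, hfk⟩ := hfar _ hx1 hx2
    refine ⟨?_, ?_⟩
    · ext v w
      rw [huH_apply, coordH_apply, hfh, kelvin_identity hρ hX hrel hz0, hsH_apply]
    · ext v w
      rw [huK_apply, coordK_apply, hfk]
      simp
  -- agreement of the patched fields with the three pieces
  have hA1 : ∀ z : E3, ‖z‖ < ρ₃ / 32 → pH z = G.coordH z ∧ pK z = G.coordK z := by
    intro z hz
    by_cases h1 : ‖z‖ < ρ₃ / 48
    · simp only [hpH, hpK, if_pos h1, and_self]
    · have hz0 : z ≠ 0 := fun h ↦ h1 (by rw [h, norm_zero]; positivity)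
      have h2 : ‖z‖ < ρ₃ := by linarith
      simp only [hpH, hpK, if_neg h1, if_pos h2]
      exact hE1 z hz0 hz
  have hA2 : ∀ z : E3, ρ₃ / 64 < ‖z‖ → ‖z‖ < 4 * ρ₃ → pH z = uH z ∧ pK z = uK z := by
    intro z hz1 hz2
    have hz0 : z ≠ 0 := fun h ↦ by rw [h, norm_zero] at hz1; linarith
    by_cases h1 : ‖z‖ < ρ₃ / 48
    · simp only [hpH, hpK, if_pos h1]
      obtain ⟨e1, e2⟩ := hE1 z hz0 (by linarith)
      exact ⟨e1.symm, e2.symm⟩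
    · by_cases h2 : ‖z‖ < ρ₃
      · simp only [hpH, hpK, if_neg h1, if_pos h2, and_self]
      · simp only [hpH, hpK, if_neg h1, if_neg h2]
        obtain ⟨e1, e2⟩ := hE2 z (by linarith) hz2
        exact ⟨e1.symm, e2.symm⟩
  have hA3 : ∀ z : E3, ρ₃ / 2 < ‖z‖ → pH z = sH z ∧ pK z = 0 := by
    intro z hz
    have h1 : ¬‖z‖ < ρ₃ / 48 := by intro h; linarith
    by_cases h2 : ‖z‖ < ρ₃
    · simp only [hpH, hpK, if_neg h1, if_pos h2]
      exact hE2 z hz (by linarith)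
    · simp only [hpH, hpK, if_neg h1, if_neg h2, and_self]
  -- the un-read datum of `D̂` on the punctured slice and the exact Schwarzschild datum
  set R : InitialDataSet (𝓡 3) Schwarzschild.puncturedSlice :=
    (Dhat.comap (inv ρ₃ ∘ Subtype.val) (contMDiff_invVal ρ₃) (injective_mfderiv_invVal hρ.ne')).homothety X₃ hX
    with hR
  have hRag : ∀ (z : E3) (hz : z ∈ Schwarzschild.puncturedSlice), ρ₃ / 64 < ‖z‖ → ‖z‖ < 4 * ρ₃ →
      (∀ v w, pH z v w = R.h.inner ⟨z, hz⟩ v w) ∧ (∀ v w, pK z v w = R.k ⟨z, hz⟩ v w) := by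
    intro z hz hz1 hz2
    obtain ⟨e1, e2⟩ := hA2 z hz1 hz2
    refine ⟨fun v w ↦ ?_, fun v w ↦ ?_⟩
    · rw [e1, hR, read_h_inner Dhat hρ.ne' hX, huH_apply]
      rfl
    · rw [e2, hR, read_k Dhat hρ.ne' hX, huK_apply]
      rfl
  set S : InitialDataSet 𝓘(ℝ, E3) Schwarzschild.puncturedSlice :=
    Schwarzschild.conformalData Schwarzschild.puncturedSlice hM.le Schwarzschild.zero_notMem_puncturedSlice
    with hSdef
  have hSag : ∀ (z : E3) (hz : z ∈ Schwarzschild.puncturedSlice), ρ₃ / 2 < ‖z‖ →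
      (∀ v w, pH z v w = S.h.inner ⟨z, hz⟩ v w) ∧ (∀ v w, pK z v w = S.k ⟨z, hz⟩ v w) := by
    intro z hz hz1
    obtain ⟨e1, e2⟩ := hA3 z hz1
    refine ⟨fun v w ↦ ?_, fun v w ↦ ?_⟩
    · rw [e1, hsH_apply, hSdef, Schwarzschild.conformalData_h_inner, Schwarzschild.conformalInner_apply]
    · rw [e2, hSdef, Schwarzschild.conformalData_k]
      rfl
  -- membership in the punctured slice
  have hmem : ∀ {z : E3} {a : ℝ}, 0 ≤ a → a < ‖z‖ → z ∈ Schwarzschild.puncturedSlice :=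
    fun ha hz ↦ lt_of_le_of_lt ha hz
  -- the patched datum
  have hloc : ∀ y : E3, ∃ (U : Opens E3) (DU : InitialDataSet 𝓘(ℝ, E3) U) (W : Set E3),
      IsOpen W ∧ y ∈ W ∧ W ⊆ U ∧
      ∀ z (hz : z ∈ U), z ∈ W →
        (∀ v w, pH z v w = DU.h.inner ⟨z, hz⟩ v w) ∧ (∀ v w, pK z v w = DU.k ⟨z, hz⟩ v w) := by
    intro y
    by_cases hy1 : ‖y‖ < ρ₃ / 32
    · refine ⟨⊤, G.comap (Subtype.val : (⊤ : Opens E3) → E3) (InitialDataSet.contMDiff_subtypeVal_succ ⊤)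
        (InitialDataSet.injective_mfderiv_subtypeVal ⊤), {z : E3 | ‖z‖ < ρ₃ / 32},
        isOpen_lt continuous_norm continuous_const, hy1, fun _ _ ↦ trivial, fun z hz hzW ↦ ?_⟩
      obtain ⟨e1, e2⟩ := hA1 z hzW
      refine ⟨fun v w ↦ ?_, fun v w ↦ ?_⟩
      · rw [comap_subtypeVal_h_inner, e1]
        rfl
      · rw [comap_subtypeVal_k, e2]
        rfl
    by_cases hy2 : ‖y‖ < 2 * ρ₃
    · refine ⟨Schwarzschild.puncturedSlice, R, {z : E3 | ρ₃ / 64 < ‖z‖ ∧ ‖z‖ < 4 * ρ₃},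
        (isOpen_lt continuous_const continuous_norm).inter (isOpen_lt continuous_norm continuous_const),
        ⟨by linarith, by linarith⟩, fun z hz ↦ hmem (by positivity) hz.1,
        fun z hz hzW ↦ hRag z hz hzW.1 hzW.2⟩
    · exact ⟨Schwarzschild.puncturedSlice, S, {z : E3 | ρ₃ / 2 < ‖z‖},
        isOpen_lt continuous_const continuous_norm, by show ρ₃ / 2 < ‖y‖; linarith,
        fun z hz ↦ hmem (by positivity) hz, fun z hz hzW ↦ hSag z hz hzW⟩
  obtain ⟨P, hPH, hPK⟩ := exists_initialDataSet_of_pieces hloc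
  -- pointwise readings of `P`
  have hP1 : ∀ y : E3, ‖y‖ < ρ₃ / 32 → P.coordH y = G.coordH y ∧ P.coordK y = G.coordK y := fun y hy ↦
    ⟨(congrFun hPH y).trans (hA1 y hy).1, (congrFun hPK y).trans (hA1 y hy).2⟩
  have hP2 : ∀ (y : E3) (hy0 : y ∈ Schwarzschild.puncturedSlice), ρ₃ / 64 < ‖y‖ → ‖y‖ < 4 * ρ₃ →
      (∀ v w, P.h.inner y v w = R.h.inner ⟨y, hy0⟩ v w) ∧ (∀ v w, P.k y v w = R.k ⟨y, hy0⟩ v w) := by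
    intro y hy0 hy1 hy2
    obtain ⟨e1, e2⟩ := hRag y hy0 hy1 hy2
    exact ⟨fun v w ↦ by rw [← e1 v w, ← congrFun hPH y]; rfl, fun v w ↦ by rw [← e2 v w, ← congrFun hPK y]; rfl⟩
  have hP3 : ∀ (y : E3) (hy0 : y ∈ Schwarzschild.puncturedSlice), ρ₃ / 2 < ‖y‖ →
      (∀ v w, P.h.inner y v w = S.h.inner ⟨y, hy0⟩ v w) ∧ (∀ v w, P.k y v w = S.k ⟨y, hy0⟩ v w) := by
    intro y hy0 hy1
    obtain ⟨e1, e2⟩ := hSag y hy0 hy1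
    exact ⟨fun v w ↦ by rw [← e1 v w, ← congrFun hPH y]; rfl, fun v w ↦ by rw [← e2 v w, ← congrFun hPK y]; rfl⟩
  refine ⟨P, fun y hy ↦ ?_, fun y hy ↦ ?_, fun y hy ↦ ?_, fun y hy1 hy2 hvac ↦ ?_, fun y hy hvac ↦ ?_⟩
  · -- exact Schwarzschild beyond `ρ₃/2`
    obtain ⟨e1, e2⟩ := hA3 y hy
    refine ⟨fun v w ↦ ?_, ?_⟩
    · rw [← coordH_apply P, congrFun hPH y, e1, hsH_apply]
    · change P.coordK y = 0
      rw [congrFun hPK y, e2]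
  · -- equal to `G` inside radius `ρ₃/32`
    exact hP1 y hy
  · -- vacuum beyond `ρ₃/2` (the exact piece is vacuum)
    refine vacAt_of_model P S (W := {z : E3 | ρ₃ / 2 < ‖z‖}) (isOpen_lt continuous_const continuous_norm)
      (fun z hz ↦ hmem (by positivity) hz) hy (fun z hz hzW ↦ hP3 z hz hzW) ?_
    intro _
    exact Schwarzschild.conformalData_isVacuumConstraintSolution_holds (M := M) hM.le
      Schwarzschild.zero_notMem_puncturedSlice _
  · -- vacuum where `D̂` is, through the un-read datum
    refine vacAt_of_model P R (W := {z : E3 | ρ₃ / 64 < ‖z‖ ∧ ‖z‖ < 4 * ρ₃})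
      ((isOpen_lt continuous_const continuous_norm).inter (isOpen_lt continuous_norm continuous_const))
      (fun z hz ↦ hmem (by positivity) hz.1) ⟨hy1, by linarith⟩ (fun z hz hzW ↦ hP2 z hz hzW.1 hzW.2) ?_
    exact read_vacAt Dhat hρ.ne' hX ⟨y, _⟩ hvac
  · -- vacuum where `G` is, inside radius `ρ₃/32`
    exact vacAt_of_eqOn P G (W := {z : E3 | ‖z‖ < ρ₃ / 32}) (isOpen_lt continuous_norm continuous_const) hy
      (fun z hz ↦ (hP1 z hz).1) (fun z hz ↦ (hP1 z hz).2) hvac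

/-! ### The stub -/

/-- **Stub `stub_capEnd`** (registered signature, line `Sketch`, crux item
stmt-FinalStateConjecture-10051; verbatim the sibling crux 10052's `stub_capEnd`): capping the end
through the inversion chart — the inverted reading exists as a datum on `ℝ³` with the vacuum
constraints transferred (`exists_capDatum`), and every unit-scale datum agreeing with it outside the
ball of radius `32` and equal to the sheet-2 far field on `{1/4 < |x| < 2}` transplants back to a
datum exactly isotropic Schwarzschild(`M`) beyond `ρ₃/2` (`exists_transplant`, Kelvin's identity).
Misner–Thorne–Wheeler 1973, §31.7; Bartnik–Isenberg 2004, §2. [folklore] -/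
theorem stub_capEnd :
  ∀ (M ρ₃ X₃ : ℝ), 0 < M → 0 < ρ₃ → 0 < X₃ → X₃ * ρ₃ = (M / 2) ^ 2 →
    ∀ G : InitialDataSet (𝓡 3) E3, CapEndAt M ρ₃ X₃ G := by
  intro M ρ₃ X₃ hM hρ hX hrel G
  obtain ⟨Ghat, hread, hvac⟩ := exists_capDatum G hρ hX
  exact ⟨Ghat, hread, hvac, fun Dhat hS hfar ↦ exists_transplant hM hρ hX hrel G Ghat Dhat hread hS hfar⟩

end Main


end Summit.FinalStateConjecture.FinalStateConjecture.Theorems.SwallowTheDatum.UniversalWitnessFamily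

end
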